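import Literature.Analysis.FluidPDE.LocalTypeI
import Literature.Analysis.FluidPDE.LerayHopfConcatenation
import Literature.Analysis.FluidPDE.ClassicalSolution
import HarnessLib

/-!
# Route `ExtremiserTransience`, crux `NearExtremalTransiencePerFlow` (stmt-NavierStokesRegularity-26567) —
# LINE g9-α «filament budget ⊕ chain gap», stub F1: slice bookkeeping for the filament budget

`--supports stmt-NavierStokesRegularity-26567`.  Prover seat ns-net-p2 (g5).  Elementary tools for
`Theorems/ExtremiserTransienceNearExtremalTransiencePerFlowStubFlowFilamentBudget.lean` (the proof of
`FlowFilamentBudget` of `Cruxes/NearExtremalTransiencePerFlow/Lines/filament_gap.lean`):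

* `continuousAt_ballEnergy` — `t ↦ ∫_{B(x,r)}|u(t)|²` is continuous below `T` for a jointly continuous field;
* `le_of_ae_le_of_continuousAt` — an a.e. bound on an open interval holds everywhere for a continuous function;
* `ae_ballEnergy_le_of_cknAEss_le` — Albritton–Barker's `A(Q_r(T,x)) ≤ K` gives `∫_{B(x,r)}|u(t)|² ≤ K r` for
  a.e. `t ∈ (T − r², T)`;
* `ballEnergy_le_of_rate` — the sup-bound regime `r² ≤ T − t`: `∫_{B(x,r)}|u(t)|² ≤ |B₁| C² r`;
* `ballEnergy_le_energy` — the energy regime: `∫_{B(x,r)}|u(t)|² ≤ ∫|u(0)|²` (Leray–Hopf energy inequality).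

Nothing about Navier–Stokes regularity is proved here; no summit is proved by a line. [folklore]
-/

noncomputable section

open MeasureTheory Filter Set Metric Function Topology TopologicalSpace
open scoped ENNReal NNReal Topology
open Literature.Analysis.FluidPDE

namespace Summit.NavierStokesRegularity.NavierStokesRegularity.Theorems

set_option linter.dupNamespace false

namespace NearExtremalTransiencePerFlow.FilamentGap
/-! ## §1 Slice bookkeeping -/

/-- Continuity in time of the energy of a ball, for a field jointly continuous on `[0,T) × ℝ³`
(dominated convergence on the ball, the field being bounded on a compact neighbourhood). [folklore] -/
theorem continuousAt_ballEnergy {T : ℝ}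
    {u : ℝ → EuclideanSpace ℝ (Fin 3) → EuclideanSpace ℝ (Fin 3)}
    (hu : ContinuousOn (uncurry u) (Ico 0 T ×ˢ univ)) (x : EuclideanSpace ℝ (Fin 3)) (r : ℝ)
    {t₀ : ℝ} (ht₀ : t₀ ∈ Ioo 0 T) :
    ContinuousAt (fun t => ∫ y in ball x r, ‖u t y‖ ^ 2) t₀ := by
  -- a compact neighbourhood `[t₀ - δ, t₀ + δ] × B̄(x, r)` inside `[0,T) × ℝ³`
  obtain ⟨δ, hδ0, hδ⟩ : ∃ δ : ℝ, 0 < δ ∧ Icc (t₀ - δ) (t₀ + δ) ⊆ Ioo 0 T := by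
    refine ⟨min t₀ (T - t₀) / 2, by
      have := lt_min ht₀.1 (sub_pos.2 ht₀.2); positivity, fun t ht => ⟨?_, ?_⟩⟩
    · have h1 : min t₀ (T - t₀) ≤ t₀ := min_le_left _ _
      linarith [ht.1, ht₀.1, ht₀.2]
    · have h1 : min t₀ (T - t₀) ≤ T - t₀ := min_le_right _ _
      linarith [ht.2, ht₀.1, ht₀.2]
  set K : Set (ℝ × EuclideanSpace ℝ (Fin 3)) := Icc (t₀ - δ) (t₀ + δ) ×ˢ closedBall x r with hK
  have hKc : IsCompact K := isCompact_Icc.prod (isCompact_closedBall x r)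
  have hKsub : K ⊆ Ico 0 T ×ˢ univ :=
    prod_mono (hδ.trans Ioo_subset_Ico_self) (subset_univ _)
  obtain ⟨M, hM⟩ := hKc.exists_bound_of_continuousOn (hu.mono hKsub)
  have hnhds : Icc (t₀ - δ) (t₀ + δ) ∈ 𝓝 t₀ := Icc_mem_nhds (by linarith) (by linarith)
  -- slices are continuous
  have hslice : ∀ t ∈ Ico 0 T, Continuous (u t) := fun t ht =>
    hu.comp_continuous (continuous_const.prodMk continuous_id) fun y => ⟨ht, mem_univ y⟩
  refine continuousAt_of_dominated (bound := fun _ => M ^ 2) ?_ ?_ ?_ ?_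
  · filter_upwards [hnhds] with t ht
    exact ((hslice t (Ioo_subset_Ico_self (hδ ht))).norm.pow 2).aestronglyMeasurable
  · filter_upwards [hnhds] with t ht
    refine ae_restrict_of_forall_mem measurableSet_ball fun y hy => ?_
    have hb : ‖u t y‖ ≤ M := hM (t, y) ⟨ht, ball_subset_closedBall hy⟩
    rw [norm_pow, norm_norm]
    exact pow_le_pow_left₀ (norm_nonneg _) hb 2
  · exact integrableOn_const measure_ball_lt_top.ne
  · refine Eventually.of_forall fun y => ?_
    have hc : ContinuousAt (uncurry u) (t₀, y) :=
      hu.continuousAt (prod_mem_nhds (Ico_mem_nhds ht₀.1 ht₀.2) univ_mem)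
    have hc' : ContinuousAt (fun t : ℝ => uncurry u (t, y)) t₀ :=
      hc.comp (f := fun t : ℝ => ((t, y) : ℝ × EuclideanSpace ℝ (Fin 3))) (by fun_prop)
    exact hc'.norm.pow 2

/-- A function continuous on an open interval and at most `c` almost everywhere there is at most `c`
everywhere there. [folklore] -/
theorem le_of_ae_le_of_continuousAt {g : ℝ → ℝ} {a b c : ℝ}
    (hg : ∀ t ∈ Ioo a b, ContinuousAt g t)
    (hae : ∀ᵐ t ∂(volume.restrict (Ioo a b)), g t ≤ c) : ∀ t ∈ Ioo a b, g t ≤ c := by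
  intro t₀ ht₀
  by_contra hle
  have hlt : c < g t₀ := not_le.1 hle
  have h1 : {t | c < g t} ∈ 𝓝 t₀ := (hg t₀ ht₀).preimage_mem_nhds (Ioi_mem_nhds hlt)
  have h2 : {t | c < g t} ∩ Ioo a b ∈ 𝓝 t₀ := inter_mem h1 (Ioo_mem_nhds ht₀.1 ht₀.2)
  have hpos : 0 < volume ({t | c < g t} ∩ Ioo a b) := Measure.measure_pos_of_mem_nhds volume h2
  have hzero : volume ({t | ¬ g t ≤ c} ∩ Ioo a b) = 0 := by
    have h := hae
    rw [ae_iff, Measure.restrict_apply' measurableSet_Ioo] at h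
    exact h
  have hsub : {t | c < g t} ∩ Ioo a b ⊆ {t | ¬ g t ≤ c} ∩ Ioo a b :=
    inter_subset_inter_left _ fun t ht => not_le.2 ht
  exact absurd (measure_mono_null hsub hzero) hpos.ne'

/-- `ofReal (‖a‖²) = ‖a‖ₑ²`. [folklore] -/
theorem ofReal_norm_sq_eq_enorm_sq (a : EuclideanSpace ℝ (Fin 3)) :
    ENNReal.ofReal (‖a‖ ^ 2) = ‖a‖ₑ ^ 2 := by
  rw [ENNReal.ofReal_pow (norm_nonneg _), ofReal_norm]

/-- From the `esssup` bound `A(Q_r(T,x)) ≤ K` to the slice bound `∫_{B(x,r)}|u(t)|² ≤ K r` for a.e.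
`t ∈ (T − r², T)` (continuous slices). [folklore] -/
theorem ae_ballEnergy_le_of_cknAEss_le
    {u : ℝ → EuclideanSpace ℝ (Fin 3) → EuclideanSpace ℝ (Fin 3)} {x : EuclideanSpace ℝ (Fin 3)}
    {T r : ℝ} (hr : 0 < r) {K : ℝ≥0}
    (hK : cknAEss r ((T, x) : ℝ × EuclideanSpace ℝ (Fin 3)) u ≤ K)
    (hcont : ∀ t ∈ Ioo (T - r ^ 2) T, Continuous (u t)) :
    ∀ᵐ t ∂(volume.restrict (Ioo (T - r ^ 2) T)), ∫ y in ball x r, ‖u t y‖ ^ 2 ≤ K * r := by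
  have hr0 : ENNReal.ofReal r ≠ 0 := (ENNReal.ofReal_pos.2 hr).ne'
  have hrT : ENNReal.ofReal r ≠ ∞ := ENNReal.ofReal_ne_top
  have hess := ENNReal.ae_le_essSup
    (μ := volume.restrict (Ioo (T - r ^ 2) T))
    (fun t : ℝ => (ENNReal.ofReal r)⁻¹ * ∫⁻ y in ball x r, ‖u t y‖ₑ ^ 2)
  filter_upwards [hess, ae_restrict_mem measurableSet_Ioo] with t ht htI
  have h1 : (ENNReal.ofReal r)⁻¹ * ∫⁻ y in ball x r, ‖u t y‖ₑ ^ 2 ≤ K := ht.trans hK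
  have h2 : ∫⁻ y in ball x r, ‖u t y‖ₑ ^ 2 ≤ ENNReal.ofReal r * K := by
    calc ∫⁻ y in ball x r, ‖u t y‖ₑ ^ 2
        = ENNReal.ofReal r * ((ENNReal.ofReal r)⁻¹ * ∫⁻ y in ball x r, ‖u t y‖ₑ ^ 2) := by
          rw [← mul_assoc, ENNReal.mul_inv_cancel hr0 hrT, one_mul]
      _ ≤ ENNReal.ofReal r * K := by gcongr
  have hmeas : AEStronglyMeasurable (fun y => ‖u t y‖ ^ 2) (volume.restrict (ball x r)) :=
    (((hcont t htI).norm.pow 2)).aestronglyMeasurable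
  rw [integral_eq_lintegral_of_nonneg_ae (Eventually.of_forall fun y => sq_nonneg _) hmeas]
  have h3 : ∫⁻ y in ball x r, ENNReal.ofReal (‖u t y‖ ^ 2) = ∫⁻ y in ball x r, ‖u t y‖ₑ ^ 2 :=
    lintegral_congr fun y => ofReal_norm_sq_eq_enorm_sq _
  rw [h3]
  have h4 : (ENNReal.ofReal r * K).toReal = K * r := by
    rw [ENNReal.toReal_mul, ENNReal.toReal_ofReal hr.le, ENNReal.coe_toReal, mul_comm]
  rw [← h4]
  exact ENNReal.toReal_mono (ENNReal.mul_ne_top hrT ENNReal.coe_ne_top) h2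

/-- The sup-bound regime: under `√(T−t)‖u(t,y)‖ ≤ C` for all `y` and `r² ≤ T − t`,
`∫_{B(x,r)}|u(t)|² ≤ |B₁| C² r`. [folklore] -/
theorem ballEnergy_le_of_rate {v : EuclideanSpace ℝ (Fin 3) → EuclideanSpace ℝ (Fin 3)} {C s r : ℝ}
    (hs : 0 < s) (hrate : ∀ y, Real.sqrt s * ‖v y‖ ≤ C) (hr : 0 < r) (hrs : r ^ 2 ≤ s)
    (x : EuclideanSpace ℝ (Fin 3)) :
    ∫ y in ball x r, ‖v y‖ ^ 2 ≤
      (volume (ball (0 : EuclideanSpace ℝ (Fin 3)) 1)).toReal * C ^ 2 * r := by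
  have hsq : 0 < Real.sqrt s := Real.sqrt_pos.2 hs
  have hC0 : 0 ≤ C := le_trans (mul_nonneg hsq.le (norm_nonneg _)) (hrate x)
  have hpt : ∀ y, ‖v y‖ ^ 2 ≤ C ^ 2 / s := by
    intro y
    have h1 : ‖v y‖ ≤ C / Real.sqrt s := by
      rw [le_div_iff₀ hsq, mul_comm]; exact hrate y
    have h2 : ‖v y‖ ^ 2 ≤ (C / Real.sqrt s) ^ 2 := pow_le_pow_left₀ (norm_nonneg _) h1 2
    rwa [div_pow, Real.sq_sqrt hs.le] at h2
  have hvol : (volume (ball x r)).toReal = r ^ 3 * (volume (ball (0 : EuclideanSpace ℝ (Fin 3)) 1)).toReal := by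
    rw [Measure.addHaar_ball volume x hr.le, finrank_euclideanSpace_fin, ENNReal.toReal_mul,
      ENNReal.toReal_ofReal (by positivity)]
  have hbound : ‖∫ y in ball x r, ‖v y‖ ^ 2‖ ≤ C ^ 2 / s * (volume (ball x r)).toReal := by
    have h := norm_setIntegral_le_of_norm_le_const (μ := volume) (s := ball x r)
      (f := fun y => ‖v y‖ ^ 2) (C := C ^ 2 / s) measure_ball_lt_top fun y _ => by
        rw [norm_pow, norm_norm]; exact hpt y
    simpa [measureReal_def] using h
  have hnn : 0 ≤ ∫ y in ball x r, ‖v y‖ ^ 2 := integral_nonneg fun y => sq_nonneg _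
  rw [Real.norm_of_nonneg hnn, hvol] at hbound
  have hV : 0 ≤ (volume (ball (0 : EuclideanSpace ℝ (Fin 3)) 1)).toReal := ENNReal.toReal_nonneg
  calc ∫ y in ball x r, ‖v y‖ ^ 2 ≤ C ^ 2 / s * (r ^ 3 * (volume (ball (0 : EuclideanSpace ℝ (Fin 3)) 1)).toReal) :=
        hbound
    _ = (volume (ball (0 : EuclideanSpace ℝ (Fin 3)) 1)).toReal * C ^ 2 * r * (r ^ 2 / s) := by
        field_simp
    _ ≤ (volume (ball (0 : EuclideanSpace ℝ (Fin 3)) 1)).toReal * C ^ 2 * r * 1 :=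
        mul_le_mul_of_nonneg_left (by rw [div_le_one hs]; exact hrs)
          (mul_nonneg (mul_nonneg hV (sq_nonneg _)) hr.le)
    _ = (volume (ball (0 : EuclideanSpace ℝ (Fin 3)) 1)).toReal * C ^ 2 * r := mul_one _

/-- The energy regime: `∫_{B(x,r)}|u(t)|² ≤ ∫|u(0)|²` for an unforced Leray–Hopf solution.
[cite: RobinsonRodrigoSadowski2016, Def. 4.9] -/
theorem ballEnergy_le_energy {T ν : ℝ} (hν : 0 ≤ ν)
    {u : ℝ → EuclideanSpace ℝ (Fin 3) → EuclideanSpace ℝ (Fin 3)}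
    (hLH : IsLerayHopfOn T ν 0 (u 0) u) {t : ℝ} (ht : t ∈ Icc 0 T) (x : EuclideanSpace ℝ (Fin 3)) (r : ℝ) :
    ∫ y in ball x r, ‖u t y‖ ^ 2 ≤ 2 * VectorCalculus.kineticEnergy (u 0) := by
  have hint : Integrable (fun y => ‖u t y‖ ^ 2) volume := (hLH.memLp t ht).integrable_norm_pow two_ne_zero
  have h1 : ∫ y in ball x r, ‖u t y‖ ^ 2 ≤ ∫ y, ‖u t y‖ ^ 2 :=
    setIntegral_le_integral hint (Eventually.of_forall fun y => sq_nonneg _)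
  have h2 : ∫ y, ‖u t y‖ ^ 2 = 2 * VectorCalculus.kineticEnergy (u t) := by
    unfold VectorCalculus.kineticEnergy; ring
  have h3 := hLH.kineticEnergy_le_of_zero_force hν ht
  linarith


end NearExtremalTransiencePerFlow.FilamentGap

end Summit.NavierStokesRegularity.NavierStokesRegularity.Theorems

end
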